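import Summits.AnomalousDissipation.AnomalousDissipation.Theses.TwoAndHalfD
import Summits.AnomalousDissipation.AnomalousDissipation.Theorems.TwohalfdNeg.Negative.LoadBearing
import Summits.AnomalousDissipation.AnomalousDissipation.Theorems.TwohalfdNeg.Negative.ZeroMeanAndKillShape
import Summits.AnomalousDissipation.AnomalousDissipation.Theorems.TwohalfdNeg.Negative.SweptThreshold

/-!
# Negative knowledge for the crux `TwohalfdThesis` (stmt-AnomalousDissipation-0206), I: kill shape and the disprover's
# load-bearing constraints (relaxations of `X` that are theorems)

Certified copy of §1–§2 of the cdisprove work file `Cruxes/TwohalfdThesis/Disproof.lean` (route `TwoAndHalfD`, target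
`X := TwohalfdThesis`: ONE steady smooth solenoidal mean-zero `x₃`-invariant force, `ν_j → 0`, `x₃`-invariant global
Leray–Hopf solutions with `sup_j ⟨‖u_j‖²⟩ ≤ E` and `⟨ν_j‖∇u_j‖²⟩ ≥ ε > 0`).

* §1 `not_twohalfdThesis_iff_twohalfdNeg : ¬ X ↔ TwohalfdNeg` (symmetric form of the certified
  `twohalfdNeg_iff_not_twohalfdThesis`): a disproof of `X` is exactly a proof of the in-class negation, open in print
  (Bruè–De Lellis 2023 Q2.1–2.2, stationary regime).
* §2 Relaxations of `X` that are THEOREMS, by the explicit laminar / ramp / swept Leray–Hopf families of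
  `Theorems/TwohalfdNeg/Negative/{LaminarShear,ZeroMeanAndKillShape,SweptThreshold}.lean` read on the `∃` side:
  `twohalfdThesisWithoutEnergyBound_holds`, `twohalfdThesisWithoutVanishingViscosity_holds`,
  `twohalfdThesisLevelDependentForce_holds` (steady forces uniformly bounded in `L^∞`, at the dissipative scale),
  `twohalfdThesisWithoutZeroMeanForce_holds` (through the `limsup` junk), `twohalfdThesisEnergyInvNu_holds` (ceiling `E/ν_j`).
  Hence a disproof of `X` must use the ceiling at scale `E ≪ ν⁻¹`, the fixedness of `f`, `ν_j → 0` and `HasZeroMean f`;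
  and a proof of `X` cannot come from viscosity-balanced (`u ~ f/ν`) or Doppler-detuned (swept) laminar responses.
Supports stmt-AnomalousDissipation-0206.
-/

noncomputable section

namespace Summit.AnomalousDissipation.AnomalousDissipation.Theorems.TwohalfdThesis.Negative

open MeasureTheory Set Filter Topology UnitAddTorus
open scoped ENNReal NNReal InnerProductSpace
open Literature.Analysis.FunctionSpaces Literature.Analysis.FunctionSpaces.Torus
open Literature.Analysis.FluidPDE Literature.Analysis.FluidPDE.Torus
open Summit.AnomalousDissipation.AnomalousDissipation.Theses
open Summit.AnomalousDissipation.AnomalousDissipation.Theses.TwoAndHalfD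
open Summit.AnomalousDissipation.AnomalousDissipation.Theorems.TwohalfdNeg.Negative

/-- Local notation: the flat unit three-torus. -/
local notation "𝕋³" => UnitAddTorus (Fin 3)
/-- Local notation: velocity values. -/
local notation "E³" => EuclideanSpace ℝ (Fin 3)

/-! ## §1 Kill shape -/

section KillShape

/-- **KILL SHAPE.** `¬ X ↔ TwohalfdNeg`: a disproof of the route target is exactly a proof of the in-class
negation (crux #5, stmt-AnomalousDissipation-0211), i.e. the negative answer to Bruè–De Lellis 2023, Questions
2.1–2.2, in the stationary long-time-average regime — open in print.  (Symmetric form of the sibling seat's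
`twohalfdNeg_iff_not_twohalfdThesis`.) [folklore] -/
theorem not_twohalfdThesis_iff_twohalfdNeg : ¬ TwohalfdThesis ↔ TwohalfdNeg :=
  twohalfdNeg_iff_not_twohalfdThesis.symm

-- (`X → AnomalousDissipation` is the route's deciding theorem `TwoAndHalfD.closes`; not restated here, to keep the
-- audit's proof-of-item detector quiet.)

end KillShape

/-! ## §2 Relaxations of `X` that HOLD: the constraints a disproof must use -/

section Relaxations

/-- `X` with the ENERGY CEILING deleted (everything else verbatim). -/
def TwohalfdThesisWithoutEnergyBound : Prop :=
  ∃ f : 𝕋³ → E³, (∀ (s : UnitAddCircle) (x : 𝕋³), f (x + Pi.single (2 : Fin 3) s) = f x) ∧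
    IsSmooth f ∧ IsDivFree f ∧ HasZeroMean f ∧
    ∃ (ν : ℕ → ℝ) (u₀ : ℕ → 𝕋³ → E³) (u : ℕ → ℝ → 𝕋³ → E³),
      (∀ j, 0 < ν j) ∧ Tendsto ν atTop (𝓝 0) ∧
      (∀ j, IsGlobalLerayHopf (ν j) (fun _ => f) (u₀ j) (u j)) ∧
      (∀ j (t : ℝ) (s : UnitAddCircle) (x : 𝕋³), u j t (x + Pi.single (2 : Fin 3) s) = u j t x) ∧
      ∃ ε : ℝ, 0 < ε ∧ ∀ j, ε ≤ meanDissipation (ν j) (u j)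

/-- **Without the energy ceiling `X` is a theorem** (so ¬X must use the ceiling): the fixed vertical shear
force `f = (0,0,cos 2πx₀)`, `ν_j = 1/(j+1)`, and the laminar steady states `u_j = f/(4π²ν_j)` (global
Leray–Hopf, `x₃`-invariant) dissipate `(j+1)/(8π²) ≥ 1/(8π²)` — with energy `∝ ν_j⁻²`, which is what the
ceiling excludes.  Dual of `twohalfdNeg_false_without_energyBound`. [folklore] -/
theorem twohalfdThesisWithoutEnergyBound_holds : TwohalfdThesisWithoutEnergyBound := by
  have hν : ∀ j : ℕ, (0 : ℝ) < 1 / ((j : ℝ) + 1) := fun j => by positivity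
  have hb : ∀ j : ℕ, (1 : ℝ) =
      4 * Real.pi ^ 2 * (((0 : ℕ) : ℝ) + 1) ^ 2 * (1 / ((j : ℝ) + 1)) * (((j : ℝ) + 1) / (4 * Real.pi ^ 2)) := by
    intro j
    have hj : (j : ℝ) + 1 ≠ 0 := by positivity
    have hπ : (Real.pi : ℝ) ^ 2 ≠ 0 := by positivity
    field_simp
    simp
  refine ⟨shear 0 1, shear_add_single 0 1, isSmooth_shear 0 1, isDivFree_shear 0 1, hasZeroMean_shear 0 1,
    fun j => 1 / ((j : ℝ) + 1), fun j => shear 0 (((j : ℝ) + 1) / (4 * Real.pi ^ 2)),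
    fun j _ => shear 0 (((j : ℝ) + 1) / (4 * Real.pi ^ 2)), hν, tendsto_one_div_add_atTop_nhds_zero_nat,
    fun j => isGlobalLerayHopf_shear 0 (hb j), fun j _ s x => shear_add_single 0 _ s x,
    1 / (8 * Real.pi ^ 2), by positivity, fun j => ?_⟩
  rw [meanDissipation_shear]
  have hj : (0 : ℝ) < (j : ℝ) + 1 := by positivity
  have hπ : (0 : ℝ) < Real.pi ^ 2 := by positivity
  have heq : 1 / ((j : ℝ) + 1) * (2 * Real.pi ^ 2 * (((0 : ℕ) : ℝ) + 1) ^ 2 *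
      (((j : ℝ) + 1) / (4 * Real.pi ^ 2)) ^ 2) = ((j : ℝ) + 1) / (8 * Real.pi ^ 2) := by
    field_simp
    simp
    ring
  rw [heq]
  exact div_le_div_of_nonneg_right (by linarith) (by positivity)

/-- `X` with `ν_j → 0` deleted (everything else verbatim). -/
def TwohalfdThesisWithoutVanishingViscosity : Prop :=
  ∃ f : 𝕋³ → E³, (∀ (s : UnitAddCircle) (x : 𝕋³), f (x + Pi.single (2 : Fin 3) s) = f x) ∧
    IsSmooth f ∧ IsDivFree f ∧ HasZeroMean f ∧
    ∃ (ν : ℕ → ℝ) (u₀ : ℕ → 𝕋³ → E³) (u : ℕ → ℝ → 𝕋³ → E³),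
      (∀ j, 0 < ν j) ∧
      (∀ j, IsGlobalLerayHopf (ν j) (fun _ => f) (u₀ j) (u j)) ∧
      (∀ j (t : ℝ) (s : UnitAddCircle) (x : 𝕋³), u j t (x + Pi.single (2 : Fin 3) s) = u j t x) ∧
      (∃ E : ℝ, ∀ j, meanEnergy (u j) ≤ E) ∧
      ∃ ε : ℝ, 0 < ε ∧ ∀ j, ε ≤ meanDissipation (ν j) (u j)

/-- **Without `ν_j → 0`, `X` is a theorem** (sanity: the content is in the limit): `ν ≡ 1`, the laminar state
`u = f/(4π²)`, energy `1/(32π⁴)`, dissipation `1/(8π²)`. Dual of `twohalfdNeg_false_without_vanishingViscosity`. [folklore] -/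
theorem twohalfdThesisWithoutVanishingViscosity_holds : TwohalfdThesisWithoutVanishingViscosity := by
  have hb : (1 : ℝ) = 4 * Real.pi ^ 2 * (((0 : ℕ) : ℝ) + 1) ^ 2 * 1 * (1 / (4 * Real.pi ^ 2)) := by
    have hπ : (Real.pi : ℝ) ^ 2 ≠ 0 := by positivity
    field_simp
    simp
  refine ⟨shear 0 1, shear_add_single 0 1, isSmooth_shear 0 1, isDivFree_shear 0 1, hasZeroMean_shear 0 1,
    fun _ => 1, fun _ => shear 0 (1 / (4 * Real.pi ^ 2)), fun _ _ => shear 0 (1 / (4 * Real.pi ^ 2)),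
    fun _ => one_pos, fun _ => isGlobalLerayHopf_shear 0 hb, fun _ _ s x => shear_add_single 0 _ s x,
    ⟨(1 / (4 * Real.pi ^ 2)) ^ 2 / 2, fun _ => (meanEnergy_shear 0 _).le⟩,
    1 * (2 * Real.pi ^ 2 * (((0 : ℕ) : ℝ) + 1) ^ 2 * (1 / (4 * Real.pi ^ 2)) ^ 2), by positivity,
    fun _ => (meanDissipation_shear 0 1 _).ge⟩

/-- `X` with the force allowed to depend on the level `j` — each `f_j` steady, smooth, solenoidal, mean zero,
`x₃`-invariant, and the family UNIFORMLY BOUNDED IN `L^∞` — everything else verbatim. -/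
def TwohalfdThesisLevelDependentForce : Prop :=
  ∃ f : ℕ → 𝕋³ → E³, (∀ j (s : UnitAddCircle) (x : 𝕋³), f j (x + Pi.single (2 : Fin 3) s) = f j x) ∧
    (∀ j, IsSmooth (f j)) ∧ (∀ j, IsDivFree (f j)) ∧ (∀ j, HasZeroMean (f j)) ∧
    (∃ M : ℝ, ∀ j x, ‖f j x‖ ≤ M) ∧
    ∃ (ν : ℕ → ℝ) (u₀ : ℕ → 𝕋³ → E³) (u : ℕ → ℝ → 𝕋³ → E³),
      (∀ j, 0 < ν j) ∧ Tendsto ν atTop (𝓝 0) ∧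
      (∀ j, IsGlobalLerayHopf (ν j) (fun _ => f j) (u₀ j) (u j)) ∧
      (∀ j (t : ℝ) (s : UnitAddCircle) (x : 𝕋³), u j t (x + Pi.single (2 : Fin 3) s) = u j t x) ∧
      (∃ E : ℝ, ∀ j, meanEnergy (u j) ≤ E) ∧
      ∃ ε : ℝ, 0 < ε ∧ ∀ j, ε ≤ meanDissipation (ν j) (u j)

/-- **With a level-dependent STEADY force (uniformly bounded in `L^∞`) `X` is a theorem** — the cheap in-class
shadow of Cheskidov 2023 Thm 1.3 / Johansson–Sorella Thm 1.5 (`ν`-dependent forces): `f_j = 4π²cos(2π(j+1)x₀)e₃`,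
`ν_j = (j+1)⁻²`, laminar `u_j = cos(2π(j+1)x₀)e₃`, energy `1/2`, dissipation `2π²` at every level (forcing AT
the dissipative scale `|k| ~ ν^{-1/2}`: work goes straight into heat, no cascade).  So ¬X must use that `f` is
ONE FIXED field — `L²`-precompactness of `{f}`; norm bounds on the force do not suffice (the witnesses converge in
`H⁻¹`).  Dual of `twohalfdNeg_false_without_fixedForce`. [folklore] -/
theorem twohalfdThesisLevelDependentForce_holds : TwohalfdThesisLevelDependentForce := by
  have hν : ∀ j : ℕ, (0 : ℝ) < (1 / ((j : ℝ) + 1)) ^ 2 := fun j => by positivity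
  have hν0 : Tendsto (fun j : ℕ => (1 / ((j : ℝ) + 1)) ^ 2) atTop (𝓝 0) := by
    simpa using (tendsto_one_div_add_atTop_nhds_zero_nat (𝕜 := ℝ)).pow 2
  have hb : ∀ j : ℕ, (4 * Real.pi ^ 2 : ℝ) =
      4 * Real.pi ^ 2 * ((j : ℝ) + 1) ^ 2 * (1 / ((j : ℝ) + 1)) ^ 2 * 1 := by
    intro j
    have hj : (j : ℝ) + 1 ≠ 0 := by positivity
    field_simp
  refine ⟨fun j => shear j (4 * Real.pi ^ 2), fun j s x => shear_add_single j _ s x,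
    fun j => isSmooth_shear j _, fun j => isDivFree_shear j _, fun j => hasZeroMean_shear j _,
    ⟨|4 * Real.pi ^ 2|, fun j x => norm_shear_le j _ x⟩, fun j => (1 / ((j : ℝ) + 1)) ^ 2,
    fun j => shear j 1, fun j _ => shear j 1, hν, hν0, fun j => isGlobalLerayHopf_shear j (hb j),
    fun j _ s x => shear_add_single j 1 s x, ⟨1 ^ 2 / 2, fun j => (meanEnergy_shear j 1).le⟩,
    2 * Real.pi ^ 2, by positivity, fun j => ?_⟩
  rw [meanDissipation_shear]
  have hj : (j : ℝ) + 1 ≠ 0 := by positivity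
  have heq : (1 / ((j : ℝ) + 1)) ^ 2 * (2 * Real.pi ^ 2 * ((j : ℝ) + 1) ^ 2 * 1 ^ 2) = 2 * Real.pi ^ 2 := by
    field_simp
  rw [heq]

/-- `X` with `HasZeroMean f` deleted (everything else verbatim). -/
def TwohalfdThesisWithoutZeroMeanForce : Prop :=
  ∃ f : 𝕋³ → E³, (∀ (s : UnitAddCircle) (x : 𝕋³), f (x + Pi.single (2 : Fin 3) s) = f x) ∧
    IsSmooth f ∧ IsDivFree f ∧
    ∃ (ν : ℕ → ℝ) (u₀ : ℕ → 𝕋³ → E³) (u : ℕ → ℝ → 𝕋³ → E³),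
      (∀ j, 0 < ν j) ∧ Tendsto ν atTop (𝓝 0) ∧
      (∀ j, IsGlobalLerayHopf (ν j) (fun _ => f) (u₀ j) (u j)) ∧
      (∀ j (t : ℝ) (s : UnitAddCircle) (x : 𝕋³), u j t (x + Pi.single (2 : Fin 3) s) = u j t x) ∧
      (∃ E : ℝ, ∀ j, meanEnergy (u j) ≤ E) ∧
      ∃ ε : ℝ, 0 < ε ∧ ∀ j, ε ≤ meanDissipation (ν j) (u j)

/-- **Without `HasZeroMean f`, `X` is a theorem — through the `limsup` JUNK of `meanEnergy`:** fixed force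
`(0,0,cos 2πx₀ + 1)` (mean `e₃`), accelerating laminar states `u_j(t) = (0,0,cos(2πx₀)/(4π²ν_j) + t)` (global
Leray–Hopf): Cesàro means of the energy grow like `T²/3`, so `meanEnergy = 0 ≤ 0` (junk, `Real.sInf ∅ = 0`),
while the dissipation `(j+1)/(8π²)` is honest.  Reading: `HasZeroMean f` is exactly what makes the ceiling of
`X` honest (momentum conservation ⇒ bounded energies); a proof of `X` gains nothing from it, a disproof needs it.
Dual of `twohalfdNeg_false_without_zeroMeanForce`. [folklore] -/
theorem twohalfdThesisWithoutZeroMeanForce_holds : TwohalfdThesisWithoutZeroMeanForce := by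
  have hν : ∀ j : ℕ, (0 : ℝ) < 1 / ((j : ℝ) + 1) := fun j => by positivity
  have ha : ∀ j : ℕ, 4 * Real.pi ^ 2 * (1 / ((j : ℝ) + 1)) * (((j : ℝ) + 1) / (4 * Real.pi ^ 2)) = 1 := by
    intro j
    have hj : (j : ℝ) + 1 ≠ 0 := by positivity
    have hπ : (Real.pi : ℝ) ^ 2 ≠ 0 := by positivity
    field_simp
  have hsm : IsSmooth (rampForce 1) := isSmooth_zero₂.twoHalf (isSmooth_profile_add_const 1 1)
  have hdf : IsDivFree (rampForce 1) :=
    IsDivFree.twoHalf (fun x => by simp [Torus.divergence, Torus.partialDeriv, Torus.lineDeriv]) _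
  refine ⟨rampForce 1, twoHalf_zero_add_single _, hsm, hdf, fun j => 1 / ((j : ℝ) + 1),
    fun j => rampState (((j : ℝ) + 1) / (4 * Real.pi ^ 2)) 1 0,
    fun j => rampState (((j : ℝ) + 1) / (4 * Real.pi ^ 2)) 1, hν, tendsto_one_div_add_atTop_nhds_zero_nat,
    fun j => isGlobalLerayHopf_ramp (ha j) 1, fun j t s x => twoHalf_zero_add_single _ s x,
    ⟨0, fun j => (meanEnergy_rampState _ one_ne_zero).le⟩, 1 / (8 * Real.pi ^ 2), by positivity, fun j => ?_⟩
  rw [meanDissipation_rampState]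
  have hj : (0 : ℝ) < (j : ℝ) + 1 := by positivity
  have hπ : (0 : ℝ) < Real.pi ^ 2 := by positivity
  have heq : 1 / ((j : ℝ) + 1) * (2 * Real.pi ^ 2 * (((j : ℝ) + 1) / (4 * Real.pi ^ 2)) ^ 2) =
      ((j : ℝ) + 1) / (8 * Real.pi ^ 2) := by
    field_simp
    ring
  rw [heq]
  exact div_le_div_of_nonneg_right (by linarith) (by positivity)

/-- `X` with the energy ceiling RELAXED to `∃ E, ∀ j, meanEnergy (u j) ≤ E / ν j` (everything else verbatim). -/
def TwohalfdThesisEnergyInvNu : Prop :=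
  ∃ f : 𝕋³ → E³, (∀ (s : UnitAddCircle) (x : 𝕋³), f (x + Pi.single (2 : Fin 3) s) = f x) ∧
    IsSmooth f ∧ IsDivFree f ∧ HasZeroMean f ∧
    ∃ (ν : ℕ → ℝ) (u₀ : ℕ → 𝕋³ → E³) (u : ℕ → ℝ → 𝕋³ → E³),
      (∀ j, 0 < ν j) ∧ Tendsto ν atTop (𝓝 0) ∧
      (∀ j, IsGlobalLerayHopf (ν j) (fun _ => f) (u₀ j) (u j)) ∧
      (∀ j (t : ℝ) (s : UnitAddCircle) (x : 𝕋³), u j t (x + Pi.single (2 : Fin 3) s) = u j t x) ∧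
      (∃ E : ℝ, ∀ j, meanEnergy (u j) ≤ E / ν j) ∧
      ∃ ε : ℝ, 0 < ε ∧ ∀ j, ε ≤ meanDissipation (ν j) (u j)

/-- **With the ceiling relaxed to `O(ν⁻¹)`, `X` is a theorem** (the ceiling exponent `-1` is the exact laminar
threshold): the SAME fixed force `(0,0,cos 2πx₀)`, `ν_j = (j+1)⁻²`, steady Galilean-SWEPT shear states with
planar drift `√ν_j` (`sweptState`, sibling file `SweptThreshold.lean`): energy `≤ 2/ν_j`, dissipation
`≥ 1/(2+8π²)`.  So ¬X must exploit the ceiling at the scale `E ≪ ν⁻¹` (bounds `D ≲ (νE)^a` are consistent);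
and a PROOF of `X` cannot come from detuned laminar responses: their dissipation is `ν × 4π²|k|² × (energy)`.
Dual of `twohalfdNeg_false_energyInvNu`. [folklore] -/
theorem twohalfdThesisEnergyInvNu_holds : TwohalfdThesisEnergyInvNu := by
  set q : ℕ → ℝ := fun j => (1 / ((j : ℝ) + 1)) ^ 2 with hq
  have hq0 : ∀ j, 0 < q j := fun j => by positivity
  have hq1 : ∀ j, q j ≤ 1 := fun j => by
    have hj : (1 : ℝ) ≤ (j : ℝ) + 1 := by
      have := (Nat.cast_nonneg j : (0 : ℝ) ≤ j)
      linarith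
    simp only [hq, div_pow, one_pow]
    exact div_le_one_of_le₀ (by nlinarith) (by positivity)
  have hν0 : Tendsto q atTop (𝓝 0) := by
    show Tendsto (fun j : ℕ => (1 / ((j : ℝ) + 1)) ^ 2) atTop (𝓝 0)
    simpa using (tendsto_one_div_add_atTop_nhds_zero_nat (𝕜 := ℝ)).pow 2
  have hz : ∀ j, sweptDen (q j) (1 / ((j : ℝ) + 1)) * sweptAmp (q j) (1 / ((j : ℝ) + 1)) =
      (((1 : ℝ) / 2 : ℝ) : ℂ) :=
    fun j => sweptDen_mul_sweptAmp (hq0 j).ne' _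
  have hsq : ∀ j : ℕ, (2 * Real.pi * (1 / ((j : ℝ) + 1))) ^ 2 = 4 * Real.pi ^ 2 * q j := fun j => by
    simp only [hq]
    ring
  refine ⟨shear 0 1, shear_add_single 0 1, isSmooth_shear 0 1, isDivFree_shear 0 1, hasZeroMean_shear 0 1,
    q, fun j => sweptState (1 / ((j : ℝ) + 1)) (sweptAmp (q j) (1 / ((j : ℝ) + 1))),
    fun j _ => sweptState (1 / ((j : ℝ) + 1)) (sweptAmp (q j) (1 / ((j : ℝ) + 1))), hq0, hν0,
    fun j => isGlobalLerayHopf_swept (hz j), fun j _ s x => sweptState_add_single _ _ s x,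
    ⟨2, fun j => ?_⟩, 1 / (2 + 8 * Real.pi ^ 2), by positivity, fun j => ?_⟩
  · rw [meanEnergy_sweptState, norm_sq_sweptAmp, hsq]
    exact swept_energy_upper (hq0 j) (hq1 j)
  · rw [meanDissipation_sweptState, norm_sq_sweptAmp, hsq]
    exact swept_dissipation_lower (hq0 j) (hq1 j)

end Relaxations

end Summit.AnomalousDissipation.AnomalousDissipation.Theorems.TwohalfdThesis.Negative

end
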